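import Mathlib
import Literature.Analysis.Complex.CauchyTransform
import Literature.Analysis.Complex.CauchyPompeiu
import Literature.Analysis.Complex.CauchyTransformHolderHigher
import Literature.Analysis.FunctionSpaces.ContDiffHolderSpace
import Literature.Analysis.FunctionSpaces.ContDiffHolderBilinear
import Literature.Analysis.FunctionSpaces.ContDiffHolderLocalization
import Literature.Analysis.FunctionSpaces.ContDiffHolderDiffOperator
import Summits.SmoothPoincare4.SmoothPoincare4.Theorems.SullivanDualTameOrBrodyR4HelperDecayingKernelZero
import Summits.SmoothPoincare4.SmoothPoincare4.Theorems.SullivanDualTameOrBrodyR4CoreAOperators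

/-!
# CORE-A of crux `TameOrBrodyR4` (stmt-SmoothPoincare4-7826), line `Sketch`: the kernel of the
# linearisation is trivial (lead c6, assembly layer A5)

The linearisation of the vorticity map at the base member is `h ↦ h + χ • (S₁ · T(χ₁ h))`
(`…CoreANonlinear.lean`). If `h` is in its kernel then `w̃ := T(χ₁ h)` is a decaying solution of
the upper-triangular conjugated equation `2∂̄w̃ + S w̃ = 0` and hence vanishes by
`helper_decayingKernelZero` — provided `w̃` is smooth, which follows by BOOTSTRAPPING the identity
`h = -χ • (S₁ · T(χ₁ h))` through the Hölder scale with the Cauchy-transform package (taken here as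
the named-fact hypothesis `hT : CauchyTransformHolderApriori (ℂ × ℂ) r`, turned into the
order-polymorphic bundled estimate by
`Literature.Analysis.Complex.cauchyTransform_contDiffHolder_succ`). Then `h = ∂̄ w̃ = 0`.

* `CoreA.kernel_trivial` — the theorem.
-/

-- the registered namespace `Summit.SmoothPoincare4.SmoothPoincare4.…` repeats a component
set_option linter.dupNamespace false

noncomputable section

open scoped ContDiff Topology NNReal
open Filter Set Function Metric Literature.Analysis.Complex Literature.Analysis.FunctionSpaces

namespace Summit.SmoothPoincare4.SmoothPoincare4.Cruxes.TameOrBrodyR4.Sketch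

namespace CoreA

/-- Local notation for the complex model plane `ℂ²`. -/
local notation "F2" => ℂ × ℂ

variable {r : ℝ≥0}

/-- A smooth compactly supported operator field paired with a member of `C^{m,r}_b` is a member of
`C^{m,r}_b` (the field is itself a member, `MemContDiffHolder.of_contDiff_of_hasCompactSupport`,
and the pairing is `MemContDiffHolder.bilinear`). -/
theorem memContDiffHolder_clm_apply_of_smooth (hr : r ≤ 1) {m : ℕ} {Φ : ℂ → (F2 →L[ℝ] F2)}
    (hΦ : ContDiff ℝ ∞ Φ) (hΦs : HasCompactSupport Φ) {w : ℂ → F2}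
    (hw : MemContDiffHolder m r w) : MemContDiffHolder m r (fun x => Φ x (w x)) :=
  MemContDiffHolder.bilinear hr (ContinuousLinearMap.id ℝ (F2 →L[ℝ] F2))
    (MemContDiffHolder.of_contDiff_of_hasCompactSupport hΦ hΦs hr) hw

/-- **The kernel of the linearisation is trivial.** Let `S` be a smooth, bounded, compactly
supported, upper-triangular operator field (the conjugated linearisation of
`helper_linearisationTriangular`), `χ, χ₁` real smooth cut-offs with `S = 0` where `χ ≠ 1` and
`χ₁ = 1` where `χ ≠ 0`, `χ₁` vanishing off the `ρ`-disc, and `S₁` a smooth operator field equal to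
`½ S` where `χ ≠ 0`. If `h ∈ C^{0,r}_b` satisfies `h + χ • (S₁ · T(χ₁ h)) = 0` pointwise, then
`h = 0`. -/
theorem kernel_trivial (hr0 : 0 < r) (hr1 : r < 1) (hT : CauchyTransformHolderApriori F2 r)
    (S : ℂ → F2 →L[ℝ] F2) (ρS M : ℝ) (hSs : ContDiff ℝ ∞ S)
    (hS : ∀ ξ, ρS ≤ ‖ξ‖ → S ξ = 0) (hM : ∀ ξ, ‖S ξ‖ ≤ M)
    (htri : ∀ ξ (y₁ : ℂ), S ξ (y₁, 0) = 0)
    (χ χ₁ : ℂ → ℝ) (hχ : ContDiff ℝ ∞ χ) (hχ₁ : ContDiff ℝ ∞ χ₁) (ρ : ℝ) (hρ : 0 < ρ)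
    (hχ₁ρ : ∀ z, ρ ≤ ‖z‖ → χ₁ z = 0)
    (hSχ : ∀ x, χ x ≠ 1 → S x = 0) (hχχ₁ : ∀ x, χ x ≠ 0 → χ₁ x = 1)
    (S₁ : ℂ → F2 →L[ℝ] F2) (hS₁s : ContDiff ℝ ∞ S₁)
    (hS₁ : ∀ x, χ x ≠ 0 → S₁ x = (1 / 2 : ℝ) • S x)
    (h : ContDiffHolderFunction ℂ F2 0 r)
    (hker : ∀ x, h x + χ x • S₁ x (cauchyTransformAlong (1 : ℂ) (fun w => χ₁ w • h w) x) = 0) :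
    h = 0 := by
  have hT' := cauchyTransform_contDiffHolder_succ F2 hr0 hr1 hT
  have hr1' : r ≤ 1 := hr1.le
  -- the density `d := χ₁ • h` and the function `w̃ := T d`
  set d : ℂ → F2 := fun w => χ₁ w • h w with hd
  set wt : ℂ → F2 := cauchyTransformAlong (1 : ℂ) d with hwt
  have hdz : ∀ z, ρ ≤ ‖z‖ → d z = 0 := fun z hz => by simp [hd, hχ₁ρ z hz]
  -- `h` vanishes where `χ` does, hence `d = h`
  have hhχ : ∀ x, χ x = 0 → h x = 0 := fun x hx => by
    have := hker x; rw [hx, zero_smul, add_zero] at this; exact this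
  have hdh : ∀ x, d x = h x := fun x => by
    by_cases hx : χ x = 0
    · simp [hd, hhχ x hx]
    · simp [hd, hχχ₁ x hx]
  -- bootstrap: for every `m`, the density is a member of `C^{m,r}_b` (as a function)
  have hboot : ∀ m : ℕ, ∃ g : ContDiffHolderFunction ℂ F2 m r, (g : ℂ → F2) = d := by
    intro m
    induction m with
    | zero =>
      refine ⟨ContDiffHolderFunction.coeffCLM hr1' χ₁ hχ₁ (hasCompactSupport_of_eq_zero hχ₁ρ) h,
        ?_⟩
      funext w; rfl
    | succ m ih =>
      obtain ⟨g, hg⟩ := ih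
      obtain ⟨C, -, hC⟩ := hT' m ρ hρ
      have hgz : ∀ z, ρ ≤ ‖z‖ → g z = 0 := fun z hz => by
        have := hdz z hz; rwa [← hg] at this
      obtain ⟨hmem, -, -, -⟩ := hC g hgz
      -- `d = χ₁ • h = -χ₁ χ • S₁ (T d)`, a smooth compactly supported field applied to `T g`
      have hΦ : ContDiff ℝ ∞ (fun x => (-(χ₁ x * χ x)) • S₁ x) :=
        (hχ₁.mul hχ).neg.smul hS₁s
      have hΦs : HasCompactSupport (fun x => (-(χ₁ x * χ x)) • S₁ x) := by
        have hc : HasCompactSupport (fun x => -(χ₁ x * χ x)) :=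
          ((hasCompactSupport_of_eq_zero (f := χ₁) hχ₁ρ).mul_right (f' := χ)).neg
        exact hc.smul_right (f' := S₁)
      have hmem' := memContDiffHolder_clm_apply_of_smooth hr1' hΦ hΦs hmem
      refine ⟨⟨fun x => (-(χ₁ x * χ x)) • S₁ x (cauchyTransformAlong (1 : ℂ) (g : ℂ → F2) x),
        hmem'⟩, ?_⟩
      funext x
      change (-(χ₁ x * χ x)) • S₁ x (cauchyTransformAlong (1 : ℂ) (g : ℂ → F2) x) = d x
      rw [hg]
      have hx := hker x
      -- `h x = -χ x • S₁ x (wt x)` and `d x = χ₁ x • h x`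
      have h1 : h x = -(χ x • S₁ x (cauchyTransformAlong (1 : ℂ) d x)) := eq_neg_of_add_eq_zero_left hx
      simp only [hd] at h1 ⊢
      rw [h1, smul_neg, neg_smul, smul_smul]
  -- the order-0 package for `d`
  obtain ⟨g0, hg0⟩ := hboot 0
  obtain ⟨C0, -, hC0⟩ := hT' 0 ρ hρ
  have hg0z : ∀ z, ρ ≤ ‖z‖ → g0 z = 0 := fun z hz => by
    have := hdz z hz; rwa [← hg0] at this
  obtain ⟨-, -, hdbar0, hdec0⟩ := hC0 g0 hg0z
  rw [hg0] at hdbar0 hdec0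
  -- smoothness of `w̃ = T d`
  have hsmooth : ContDiff ℝ ∞ wt := by
    rw [contDiff_infty]
    intro m
    obtain ⟨g, hg⟩ := hboot m
    obtain ⟨C, -, hC⟩ := hT' m ρ hρ
    have hgz : ∀ z, ρ ≤ ‖z‖ → g z = 0 := fun z hz => by
      have := hdz z hz; rwa [← hg] at this
    obtain ⟨hmem, -, -, -⟩ := hC g hgz
    rw [hg] at hmem
    exact (hmem.contDiff).of_le (by exact_mod_cast Nat.le_succ m)
  -- the conjugated equation `2∂̄w̃ + S w̃ = 0`
  have heq : ∀ ξ, (2 : ℂ) • dbarAlong (1 : ℂ) wt ξ + S ξ (wt ξ) = 0 := by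
    intro ξ
    rw [hdbar0 ξ, hdh ξ]
    have hx := hker ξ
    by_cases h1 : χ ξ = 1
    · rw [h1, one_smul, hS₁ ξ (by rw [h1]; exact one_ne_zero)] at hx
      -- `h ξ + ½ S (w̃ ξ) = 0`
      have h2 : h ξ = -((1 / 2 : ℝ) • S ξ (wt ξ)) := eq_neg_of_add_eq_zero_left hx
      rw [h2, smul_neg]
      have : ((2 : ℂ)) • (1 / 2 : ℝ) • (S ξ) (wt ξ) = S ξ (wt ξ) := by
        rw [two_smul, ← add_smul]; norm_num
      rw [this, neg_add_cancel]
    · have hS0 : S ξ = 0 := hSχ ξ h1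
      have hh0 : h ξ = 0 := by
        by_cases h0 : χ ξ = 0
        · exact hhχ ξ h0
        · rw [hS₁ ξ h0, hS0] at hx; simpa using hx
      rw [hh0, hS0]; simp
  -- decay, injectivity theorem, conclusion
  have hzero : wt = 0 :=
    helper_decayingKernelZero S ρS M hSs hS hM htri wt hsmooth heq hdec0
  apply ContDiffHolderFunction.ext
  intro x
  have hz' : cauchyTransformAlong (1 : ℂ) d = 0 := hzero
  have := hdbar0 x
  rw [hz'] at this
  rw [show (0 : ContDiffHolderFunction ℂ F2 0 r) x = 0 from rfl, ← hdh x, ← this]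
  simp [dbarAlong_apply]

end CoreA

/-- **Registered helper `helper_kernelTrivial`** (= `CoreA.kernel_trivial`): the kernel of the
linearisation `h ↦ h + χ • (S₁ · T(χ₁ h))` on `C^{0,r}_b` is trivial, given the a priori Hölder
estimate for the Cauchy transform and the structural facts about `S`, `χ`, `χ₁`, `S₁`. -/
theorem helper_kernelTrivial {r : ℝ≥0} (hr0 : 0 < r) (hr1 : r < 1)
    (hT : CauchyTransformHolderApriori (ℂ × ℂ) r)
    (S : ℂ → (ℂ × ℂ) →L[ℝ] (ℂ × ℂ)) (ρS M : ℝ) (hSs : ContDiff ℝ ∞ S)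
    (hS : ∀ ξ, ρS ≤ ‖ξ‖ → S ξ = 0) (hM : ∀ ξ, ‖S ξ‖ ≤ M)
    (htri : ∀ ξ (y₁ : ℂ), S ξ (y₁, 0) = 0)
    (χ χ₁ : ℂ → ℝ) (hχ : ContDiff ℝ ∞ χ) (hχ₁ : ContDiff ℝ ∞ χ₁) (ρ : ℝ) (hρ : 0 < ρ)
    (hχ₁ρ : ∀ z, ρ ≤ ‖z‖ → χ₁ z = 0)
    (hSχ : ∀ x, χ x ≠ 1 → S x = 0) (hχχ₁ : ∀ x, χ x ≠ 0 → χ₁ x = 1)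
    (S₁ : ℂ → (ℂ × ℂ) →L[ℝ] (ℂ × ℂ)) (hS₁s : ContDiff ℝ ∞ S₁)
    (hS₁ : ∀ x, χ x ≠ 0 → S₁ x = (1 / 2 : ℝ) • S x)
    (h : ContDiffHolderFunction ℂ (ℂ × ℂ) 0 r)
    (hker : ∀ x, h x + χ x • S₁ x (cauchyTransformAlong (1 : ℂ) (fun w => χ₁ w • h w) x) = 0) :
    h = 0 :=
  CoreA.kernel_trivial hr0 hr1 hT S ρS M hSs hS hM htri χ χ₁ hχ hχ₁ ρ hρ hχ₁ρ hSχ hχχ₁ S₁ hS₁s hS₁ h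
    hker

end Summit.SmoothPoincare4.SmoothPoincare4.Cruxes.TameOrBrodyR4.Sketch
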